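import Summits.QuantumFields.BalabanUV.T4Continuum.Spine.NE9.DirectPairing

/-!
# T⁴ programme, spine estimate NE9 — KING'S CURRENCY FOR A FAMILY OF TOWERS: the conclusions of `DirectPairing` hold with ONE level
# threshold `M₀` for a whole family of towers `F s` (`s ∈ σ`: the sections of the tower of carriers at every top run, background and
# domain) as soon as the separate uniform continuity moduli are uniform in `s` — census item C30 of cell `pub-balaban-gaps`, seat ne9
# (gen 6), the family form consumed by the by-name junction `TowerCarriersKing`

Cell `pub-balaban-gaps` (YM blitz G2, seat ne9, unit `pub-balaban-gaps-ne9-g6`; record `run/shared/lean/pub/pub-balaban-gaps/ne/NE9.md` §5 row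
C30).  Summits-side bookkeeping; no definition.  `DirectPairing` (p349180) proves, for ONE abstract tower `F : ℕ → (ℕ → ℝ) → ℝ`, that tower
rate + prefix dependence + SEPARATE UNIFORM CONTINUITY PER LEVEL make the (direct) bracket majorant tend to zero.  On the tower of carriers
(`TowerCarriers.TowerData`) node U3 → U6 needs this at EVERY domain `X` of EVERY run with EVERY background — a FAMILY of sections
`F s`, `s = (top run, background, domain)` — with a level threshold that does not depend on `s`: the injection fed to node U6 is a supremum
over `s`.  The proofs of `DirectPairing` §2–§4 go through VERBATIM for a family once the per-level moduli `δ(m, i, ε)` of the separate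
uniform continuity hypothesis serve all `s` at once (`hUC` below quantifies `∀ s` INSIDE `∃ δ`); this file records them in that form:
`levelUniform_family` (3ε descent, uniformly in `s`), `chain_le` reused pointwise, `bracket_eventually_le_family`,
`directBracket_eventually_le_family`.  For Bałaban's terms the uniformity in `s` at a fixed scale is uniformity over the domains and
backgrounds of that scale AND over the run (the fine structure `η`) — the printed KIND of uniformity ([Balaban1987RG1] Thm 1 p. 259 *"uniformly
in the lattice spacing"*, (1.18) p. 263 with `E₀` independent of `j`), here for a qualitative modulus (H-reading; nothing asserted).

HONEST FRAMING: real analysis on hypothesis SHAPES; NE9 and NE5 NOT PRINTED ∕ NOT PROVED; spine PROVED 0∕9 unchanged; rung (B)+1 on ONE finite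
four-torus; NOT UV stability, NOT the continuum limit, NOT infinite volume, NOT a mass gap, NOT Clay.  Classification of NE9 UNCHANGED (WORK-bound on W1).

References (TYPES only): [Balaban1987RG1] = T. Bałaban, Commun. Math. Phys. **109** (1987) 249–301, Thm 1 p. 259, p. 263; [King1986] = C. King,
Commun. Math. Phys. **102** (1986) 649–677, §3.2 pp. 656–657.
-/

namespace Summit.QuantumFields.BalabanUV.T4Continuum.NE9.DirectPairingFamily

open scoped BigOperators
open Finset Filter Topology
open Summit.QuantumFields.BalabanUV.T4Continuum.NE9.MemoryFromRate (osc_le_of_towerRate)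
open Summit.QuantumFields.BalabanUV.T4Continuum.NE9.DirectPairing
  (shift_iter_mem exists_pow_le iter_towerRate chain_le)

variable {σ : Type*} {W : Set (ℕ → ℝ)} {F : σ → ℕ → (ℕ → ℝ) → ℝ}

/-! ## §1 Level-uniformity at fixed age, uniformly over the family -/

/-- **LEVEL-UNIFORMITY FROM THE TOWER RATE, FAMILY FORM.**  Tower rate for every member (`C₅ ≥ 0`, `0 ≤ θ < 1`, shift-closed window) +
separate uniform continuity PER LEVEL with moduli serving ALL members `s` at once ⇒ for every age `a ≥ 1` and `ε > 0` ONE `δ > 0` serves all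
members and all levels `m ≥ a` at the coordinate `m − a` (3ε descent to a reference level, `DirectPairing.iter_towerRate`, + a finite minimum).
[folklore] -/
theorem levelUniform_family {C₅ θ : ℝ} (hC : 0 ≤ C₅) (hθ0 : 0 ≤ θ) (hθ1 : θ < 1)
    (hW : ∀ g ∈ W, (fun i => g (i + 1)) ∈ W)
    (hT : ∀ s m, ∀ g ∈ W, |F s (m + 1) g - F s m (fun i => g (i + 1))| ≤ C₅ * θ ^ m)
    (hUC : ∀ m i : ℕ, i < m → ∀ ε : ℝ, 0 < ε → ∃ δ : ℝ, 0 < δ ∧ ∀ s, ∀ g ∈ W, ∀ g' ∈ W,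
      (∀ k, k ≠ i → g k = g' k) → |g i - g' i| ≤ δ → |F s m g - F s m g'| ≤ ε)
    {a : ℕ} (ha : 1 ≤ a) {ε : ℝ} (hε : 0 < ε) :
    ∃ δ : ℝ, 0 < δ ∧ ∀ s, ∀ m : ℕ, a ≤ m → ∀ g ∈ W, ∀ g' ∈ W,
      (∀ k, k ≠ m - a → g k = g' k) → |g (m - a) - g' (m - a)| ≤ δ → |F s m g - F s m g'| ≤ ε := by
  obtain ⟨M₁, hM₁⟩ := exists_pow_le (C₅ / (1 - θ)) hθ0 hθ1 (show 0 < ε / 3 by positivity)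
  obtain ⟨M, hMM, hMa⟩ : ∃ M, M₁ ≤ M ∧ a ≤ M := ⟨max M₁ a, le_max_left _ _, le_max_right _ _⟩
  have hlev : ∀ m : ℕ, ∃ δ : ℝ, 0 < δ ∧ (a ≤ m → ∀ s, ∀ g ∈ W, ∀ g' ∈ W,
      (∀ k, k ≠ m - a → g k = g' k) → |g (m - a) - g' (m - a)| ≤ δ → |F s m g - F s m g'| ≤ ε / 3) := by
    intro m
    by_cases ham : a ≤ m
    · obtain ⟨δ, hδ, h⟩ := hUC m (m - a) (by omega) (ε / 3) (by positivity)
      exact ⟨δ, hδ, fun _ => h⟩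
    · exact ⟨1, one_pos, fun h => absurd h ham⟩
  choose δf hδf hF using hlev
  refine ⟨(range (M + 1)).inf' ⟨0, by simp⟩ δf, (Finset.lt_inf'_iff _).2 fun m _ => hδf m, ?_⟩
  intro s m ham g hg g' hg' hagree hdiff
  by_cases hmM : m ≤ M
  · have hδm : (range (M + 1)).inf' ⟨0, by simp⟩ δf ≤ δf m := Finset.inf'_le δf (mem_range.2 (by omega))
    have := hF m ham s g hg g' hg' hagree (hdiff.trans hδm)
    linarith
  · obtain ⟨l, rfl⟩ := Nat.exists_eq_add_of_le (le_of_lt (not_le.mp hmM))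
    have hgl : (fun i => g (i + l)) ∈ W := shift_iter_mem hW l g hg
    have hg'l : (fun i => g' (i + l)) ∈ W := shift_iter_mem hW l g' hg'
    have hdesc : C₅ / (1 - θ) * θ ^ M ≤ ε / 3 := hM₁ M hMM
    have d1 := iter_towerRate (F := F s) hC hθ0 hθ1 hW (hT s) l M hg
    have d2 := iter_towerRate (F := F s) hC hθ0 hθ1 hW (hT s) l M hg'
    have e1 : C₅ * θ ^ M / (1 - θ) = C₅ / (1 - θ) * θ ^ M := by ring
    rw [e1] at d1 d2
    have hδM : (range (M + 1)).inf' ⟨0, by simp⟩ δf ≤ δf M := Finset.inf'_le δf (by simp)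
    have hmid : |F s M (fun i => g (i + l)) - F s M (fun i => g' (i + l))| ≤ ε / 3 := by
      refine hF M hMa s _ hgl _ hg'l (fun k hk => hagree (k + l) (by omega)) ?_
      show |g (M - a + l) - g' (M - a + l)| ≤ δf M
      rw [show M - a + l = M + l - a by omega]
      exact hdiff.trans hδM
    have t1 := abs_sub_le (F s (M + l) g) (F s M fun i => g (i + l)) (F s (M + l) g')
    have t2 := abs_sub_le (F s M fun i => g (i + l)) (F s M fun i => g' (i + l)) (F s (M + l) g')
    rw [abs_sub_comm] at d2
    linarith

/-! ## §2 The bracket majorant tends to zero, uniformly over the family -/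

/-- **THE BRACKET MAJORANT TENDS TO ZERO, FAMILY FORM.**  Hypotheses of `DirectPairing.bracket_eventually_le` for every member, the separate
uniform continuity moduli serving all members at once ⇒ for every `η > 0` ONE threshold `M₀` beyond which EVERY member's bracket of every
admissible pair under the profile `P` (`P i → 0`) is `≤ η`. [folklore] -/
theorem bracket_eventually_le_family {C₅ θ : ℝ} {P : ℕ → ℝ} (hC : 0 ≤ C₅) (hθ0 : 0 ≤ θ) (hθ1 : θ < 1)
    (hW : ∀ g ∈ W, (fun i => g (i + 1)) ∈ W)
    (hWmix : ∀ g ∈ W, ∀ g' ∈ W, ∀ a : ℕ, (fun i => if i < a then g' i else g i) ∈ W)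
    (hT : ∀ s m, ∀ g ∈ W, |F s (m + 1) g - F s m (fun i => g (i + 1))| ≤ C₅ * θ ^ m)
    (hP : ∀ s m, ∀ g ∈ W, ∀ g' ∈ W, (∀ i, i < m → g i = g' i) → F s m g = F s m g')
    (hUC : ∀ m i : ℕ, i < m → ∀ ε : ℝ, 0 < ε → ∃ δ : ℝ, 0 < δ ∧ ∀ s, ∀ g ∈ W, ∀ g' ∈ W,
      (∀ k, k ≠ i → g k = g' k) → |g i - g' i| ≤ δ → |F s m g - F s m g'| ≤ ε)
    (hd : Tendsto P atTop (𝓝 0)) {η : ℝ} (hη : 0 < η) :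
    ∃ M₀ : ℕ, ∀ s, ∀ m : ℕ, M₀ ≤ m → ∀ g ∈ W, ∀ g' ∈ W,
      (∀ i, i < m → |g i - g' i| ≤ P i) → |F s m g - F s m g'| ≤ η := by
  obtain ⟨A₁, hA₁⟩ := exists_pow_le (2 * C₅ / (1 - θ)) hθ0 hθ1 (half_pos hη)
  obtain ⟨A, hAA, hA1⟩ : ∃ A, A₁ ≤ A ∧ 1 ≤ A := ⟨max A₁ 1, le_max_left _ _, le_max_right _ _⟩
  have hAold : 2 * C₅ / (1 - θ) * θ ^ A ≤ η / 2 := hA₁ A hAA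
  have hApos : (0 : ℝ) < A := by exact_mod_cast hA1
  have hage : ∀ a : ℕ, ∃ δ : ℝ, 0 < δ ∧ (1 ≤ a → ∀ s, ∀ m : ℕ, a ≤ m → ∀ g ∈ W, ∀ g' ∈ W,
      (∀ k, k ≠ m - a → g k = g' k) → |g (m - a) - g' (m - a)| ≤ δ → |F s m g - F s m g'| ≤ η / (2 * A)) := by
    intro a
    by_cases ha : 1 ≤ a
    · obtain ⟨δ, hδ, h⟩ := levelUniform_family hC hθ0 hθ1 hW hT hUC ha (show 0 < η / (2 * A) by positivity)
      exact ⟨δ, hδ, fun _ => h⟩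
    · exact ⟨1, one_pos, fun h => absurd h ha⟩
  choose δa hδa hFa using hage
  have hδpos : 0 < (range (A + 1)).inf' ⟨0, by simp⟩ δa := (Finset.lt_inf'_iff _).2 fun a _ => hδa a
  have hδle : ∀ a, a ≤ A → (range (A + 1)).inf' ⟨0, by simp⟩ δa ≤ δa a :=
    fun a ha => Finset.inf'_le δa (mem_range.2 (by omega))
  obtain ⟨I, hI⟩ := Metric.tendsto_atTop.mp hd _ hδpos
  have hPI : ∀ i, I ≤ i → P i ≤ (range (A + 1)).inf' ⟨0, by simp⟩ δa := fun i hi => by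
    have h := hI i hi
    rw [Real.dist_eq, sub_zero] at h
    exact (le_abs_self _).trans h.le
  refine ⟨I + A, fun s m hm g hg g' hg' hgg' => ?_⟩
  have hh₀W : (fun i => if i < m - A then g' i else g i) ∈ W := hWmix g hg g' hg' (m - A)
  have hold : |F s m g - F s m (fun i => if i < m - A then g' i else g i)| ≤ η / 2 := by
    have h := osc_le_of_towerRate (F := F s) hC hθ0 hθ1 hW (hT s) (a := m - A) (m := A) hg hh₀W
      (fun i hi => by simp [not_lt.mpr hi])
    rw [show A + (m - A) = m by omega] at h
    calc |F s m g - F s m (fun i => if i < m - A then g' i else g i)| ≤ 2 * C₅ * θ ^ A / (1 - θ) := h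
      _ = 2 * C₅ / (1 - θ) * θ ^ A := by ring
      _ ≤ η / 2 := hAold
  have hyoung : |F s m (fun i => if i < m - A then g' i else g i) -
      F s m (fun i => if i < m - A + A then g' i else g i)| ≤ (A : ℝ) * (η / (2 * A)) := by
    refine chain_le (F := F s) hWmix hg hg' (fun i hi1 hi2 h hh h' hh' hagree hdi => ?_)
      (fun i _ hi2 => hgg' i hi2) A (by omega)
    have him : m - (m - i) = i := by omega
    refine hFa (m - i) (by omega) s m (by omega) h hh h' hh' (by rw [him]; exact hagree) ?_
    rw [him]
    exact hdi.trans ((hPI i (by omega)).trans (hδle _ (by omega)))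
  have hlast : F s m (fun i => if i < m - A + A then g' i else g i) = F s m g' :=
    hP s m _ (hWmix g hg g' hg' _) g' hg' (fun i hi => by simp [show i < m - A + A by omega])
  have eA : (A : ℝ) * (η / (2 * A)) = η / 2 := by
    field_simp
  rw [hlast, eA] at hyoung
  have t := abs_sub_le (F s m g) (F s m fun i => if i < m - A then g' i else g i) (F s m g')
  linarith

/-- **KING'S CURRENCY, E-SIDE END, FAMILY FORM.**  For every `η > 0` ONE `M₀` such that for every member `s`, all `m ≥ M₀`, ALL `n`, and all
admissible `g` (the `n` unpaired couplings in front) and `g'` with `|g_{i+n} − g'_i| ≤ P_i` (`i < m`): `|F s (m+n) g − F s m g'| ≤ η`.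
[folklore] -/
theorem directBracket_eventually_le_family {C₅ θ : ℝ} {P : ℕ → ℝ} (hC : 0 ≤ C₅) (hθ0 : 0 ≤ θ) (hθ1 : θ < 1)
    (hW : ∀ g ∈ W, (fun i => g (i + 1)) ∈ W)
    (hWmix : ∀ g ∈ W, ∀ g' ∈ W, ∀ a : ℕ, (fun i => if i < a then g' i else g i) ∈ W)
    (hT : ∀ s m, ∀ g ∈ W, |F s (m + 1) g - F s m (fun i => g (i + 1))| ≤ C₅ * θ ^ m)
    (hP : ∀ s m, ∀ g ∈ W, ∀ g' ∈ W, (∀ i, i < m → g i = g' i) → F s m g = F s m g')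
    (hUC : ∀ m i : ℕ, i < m → ∀ ε : ℝ, 0 < ε → ∃ δ : ℝ, 0 < δ ∧ ∀ s, ∀ g ∈ W, ∀ g' ∈ W,
      (∀ k, k ≠ i → g k = g' k) → |g i - g' i| ≤ δ → |F s m g - F s m g'| ≤ ε)
    (hd : Tendsto P atTop (𝓝 0)) {η : ℝ} (hη : 0 < η) :
    ∃ M₀ : ℕ, ∀ s, ∀ m : ℕ, M₀ ≤ m → ∀ n : ℕ, ∀ g ∈ W, ∀ g' ∈ W,
      (∀ i, i < m → |g (i + n) - g' i| ≤ P i) → |F s (m + n) g - F s m g'| ≤ η := by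
  obtain ⟨M₁, hM₁⟩ := exists_pow_le (C₅ / (1 - θ)) hθ0 hθ1 (half_pos hη)
  obtain ⟨M₂, hM₂⟩ := bracket_eventually_le_family hC hθ0 hθ1 hW hWmix hT hP hUC hd (half_pos hη)
  refine ⟨max M₁ M₂, fun s m hm n g hg g' hg' hgg' => ?_⟩
  have h1 := iter_towerRate (F := F s) hC hθ0 hθ1 hW (hT s) n m hg
  have h2 := hM₂ s m (le_of_max_le_right hm) (fun i => g (i + n)) (shift_iter_mem hW n g hg) g' hg' hgg'
  have h3 : C₅ * θ ^ m / (1 - θ) ≤ η / 2 := by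
    rw [show C₅ * θ ^ m / (1 - θ) = C₅ / (1 - θ) * θ ^ m by ring]
    exact hM₁ m (le_of_max_le_left hm)
  have t := abs_sub_le (F s (m + n) g) (F s m fun i => g (i + n)) (F s m g')
  linarith

/-- The single-tower statements of `DirectPairing` are the one-member family (`σ = Unit`) — recorded so that the two files are visibly the
same mathematics. [folklore] -/
theorem bracket_eventually_le_of_family {C₅ θ : ℝ} {P : ℕ → ℝ} {F₁ : ℕ → (ℕ → ℝ) → ℝ}
    (hC : 0 ≤ C₅) (hθ0 : 0 ≤ θ) (hθ1 : θ < 1)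
    (hW : ∀ g ∈ W, (fun i => g (i + 1)) ∈ W)
    (hWmix : ∀ g ∈ W, ∀ g' ∈ W, ∀ a : ℕ, (fun i => if i < a then g' i else g i) ∈ W)
    (hT : ∀ m, ∀ g ∈ W, |F₁ (m + 1) g - F₁ m (fun i => g (i + 1))| ≤ C₅ * θ ^ m)
    (hP : ∀ m, ∀ g ∈ W, ∀ g' ∈ W, (∀ i, i < m → g i = g' i) → F₁ m g = F₁ m g')
    (hUC : ∀ m i : ℕ, i < m → ∀ ε : ℝ, 0 < ε → ∃ δ : ℝ, 0 < δ ∧ ∀ g ∈ W, ∀ g' ∈ W,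
      (∀ k, k ≠ i → g k = g' k) → |g i - g' i| ≤ δ → |F₁ m g - F₁ m g'| ≤ ε)
    (hd : Tendsto P atTop (𝓝 0)) {η : ℝ} (hη : 0 < η) :
    ∃ M₀ : ℕ, ∀ m : ℕ, M₀ ≤ m → ∀ g ∈ W, ∀ g' ∈ W,
      (∀ i, i < m → |g i - g' i| ≤ P i) → |F₁ m g - F₁ m g'| ≤ η := by
  obtain ⟨M₀, h⟩ := bracket_eventually_le_family (σ := Unit) (F := fun _ => F₁) hC hθ0 hθ1 hW hWmix (fun _ => hT) (fun _ => hP)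
    (fun m i hi ε hε => by
      obtain ⟨δ, hδ, h⟩ := hUC m i hi ε hε
      exact ⟨δ, hδ, fun _ => h⟩) hd hη
  exact ⟨M₀, h ()⟩

/-! ## §3 (appended 2026-08-23, same seat) Node U5b's currency: UNIFORM smallness of the bracket from UNIFORM closeness of the histories — the
family of towers is uniformly equicontinuous in the sup-distance of histories, uniformly in the level and the member, from the tower rate + per-level
separate uniform continuity alone (no rate of closeness, no modulus) -/

/-- **UNIFORM EQUICONTINUITY OF THE TOWER (node U5b's shape in King's currency).**  Tower rate for every member (`C₅ ≥ 0`, `0 ≤ θ < 1`, shift- and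
hybrid-closed window) + prefix dependence + separate uniform continuity per level with moduli uniform over the family ⇒ for every `η > 0` ONE `δ > 0` such
that for EVERY member `s`, EVERY level `m` and every admissible pair with `|g_i − g'_i| ≤ δ` for all `i < m`: `|F s m g − F s m g'| ≤ η`.  (Old block beyond
age `A` by `osc_le_of_towerRate`, the at most `A` young coordinates by `levelUniform_family` at tolerance `η∕(2A)`; levels `m < A` have no old block.)  This is the
uniform-in-the-level bracket bound node U5b consumes (`T4OutputRate.historySum_le_of_fadingMemory`'s role), obtained with NO fading memory, NO row sums and NO
modulus — uniform δ-closeness of the coupling histories in, uniform η-closeness of the terms out. [folklore] -/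
theorem uniformSmall_family {C₅ θ : ℝ} (hC : 0 ≤ C₅) (hθ0 : 0 ≤ θ) (hθ1 : θ < 1)
    (hW : ∀ g ∈ W, (fun i => g (i + 1)) ∈ W)
    (hWmix : ∀ g ∈ W, ∀ g' ∈ W, ∀ a : ℕ, (fun i => if i < a then g' i else g i) ∈ W)
    (hT : ∀ s m, ∀ g ∈ W, |F s (m + 1) g - F s m (fun i => g (i + 1))| ≤ C₅ * θ ^ m)
    (hP : ∀ s m, ∀ g ∈ W, ∀ g' ∈ W, (∀ i, i < m → g i = g' i) → F s m g = F s m g')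
    (hUC : ∀ m i : ℕ, i < m → ∀ ε : ℝ, 0 < ε → ∃ δ : ℝ, 0 < δ ∧ ∀ s, ∀ g ∈ W, ∀ g' ∈ W,
      (∀ k, k ≠ i → g k = g' k) → |g i - g' i| ≤ δ → |F s m g - F s m g'| ≤ ε)
    {η : ℝ} (hη : 0 < η) :
    ∃ δ : ℝ, 0 < δ ∧ ∀ s, ∀ m : ℕ, ∀ g ∈ W, ∀ g' ∈ W,
      (∀ i, i < m → |g i - g' i| ≤ δ) → |F s m g - F s m g'| ≤ η := by
  obtain ⟨A₁, hA₁⟩ := exists_pow_le (2 * C₅ / (1 - θ)) hθ0 hθ1 (half_pos hη)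
  obtain ⟨A, hAA, hA1⟩ : ∃ A, A₁ ≤ A ∧ 1 ≤ A := ⟨max A₁ 1, le_max_left _ _, le_max_right _ _⟩
  have hAold : 2 * C₅ / (1 - θ) * θ ^ A ≤ η / 2 := hA₁ A hAA
  have hApos : (0 : ℝ) < A := by exact_mod_cast hA1
  have hage : ∀ a : ℕ, ∃ δ : ℝ, 0 < δ ∧ (1 ≤ a → ∀ s, ∀ m : ℕ, a ≤ m → ∀ g ∈ W, ∀ g' ∈ W,
      (∀ k, k ≠ m - a → g k = g' k) → |g (m - a) - g' (m - a)| ≤ δ → |F s m g - F s m g'| ≤ η / (2 * A)) := by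
    intro a
    by_cases ha : 1 ≤ a
    · obtain ⟨δ, hδ, h⟩ := levelUniform_family hC hθ0 hθ1 hW hT hUC ha (show 0 < η / (2 * A) by positivity)
      exact ⟨δ, hδ, fun _ => h⟩
    · exact ⟨1, one_pos, fun h => absurd h ha⟩
  choose δa hδa hFa using hage
  refine ⟨(range (A + 1)).inf' ⟨0, by simp⟩ δa, (Finset.lt_inf'_iff _).2 fun a _ => hδa a, ?_⟩
  have hδle : ∀ a, a ≤ A → (range (A + 1)).inf' ⟨0, by simp⟩ δa ≤ δa a :=
    fun a ha => Finset.inf'_le δa (mem_range.2 (by omega))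
  intro s m g hg g' hg' hclose
  -- the cut: `a = m − k` with `k = min A m` young coordinates
  set k := min A m with hk
  have hkm : k ≤ m := min_le_right _ _
  have hkA : k ≤ A := min_le_left _ _
  -- old block: zero if `m ≤ A`, else `osc_le_of_towerRate` with age cut `A`
  have hold : |F s m g - F s m (fun i => if i < m - k then g' i else g i)| ≤ η / 2 := by
    rcases le_or_gt m A with hm | hm
    · have hk0 : m - k = 0 := by omega
      have e : (fun i => if i < m - k then g' i else g i) = g := funext fun i => by simp [hk0]
      rw [e, sub_self, abs_zero]
      exact (half_pos hη).le
    · have hkA' : k = A := by omega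
      have hh₀W : (fun i => if i < m - k then g' i else g i) ∈ W := hWmix g hg g' hg' (m - k)
      have h := osc_le_of_towerRate (F := F s) hC hθ0 hθ1 hW (hT s) (a := m - k) (m := k) hg hh₀W
        (fun i hi => by simp [not_lt.mpr hi])
      rw [show k + (m - k) = m by omega] at h
      calc |F s m g - F s m (fun i => if i < m - k then g' i else g i)| ≤ 2 * C₅ * θ ^ k / (1 - θ) := h
        _ = 2 * C₅ / (1 - θ) * θ ^ A := by rw [hkA']; ring
        _ ≤ η / 2 := hAold
  -- young block: `k ≤ A` single-coordinate steps of cost `η∕(2A)`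
  have hyoung : |F s m (fun i => if i < m - k then g' i else g i) -
      F s m (fun i => if i < m - k + k then g' i else g i)| ≤ (k : ℝ) * (η / (2 * A)) := by
    refine chain_le (F := F s) (P := fun _ => (range (A + 1)).inf' ⟨0, by simp⟩ δa) hWmix hg hg'
      (fun i hi1 hi2 h hh h' hh' hagree hdi => ?_) (fun i _ hi2 => hclose i hi2) k (by omega)
    have him : m - (m - i) = i := by omega
    refine hFa (m - i) (by omega) s m (by omega) h hh h' hh' (by rw [him]; exact hagree) ?_
    rw [him]
    exact hdi.trans (hδle _ (by omega))
  have hlast : F s m (fun i => if i < m - k + k then g' i else g i) = F s m g' :=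
    hP s m _ (hWmix g hg g' hg' _) g' hg' (fun i hi => by simp [show i < m - k + k by omega])
  have hkη : (k : ℝ) * (η / (2 * A)) ≤ η / 2 := by
    have hkA'' : (k : ℝ) ≤ A := by exact_mod_cast hkA
    have e : (A : ℝ) * (η / (2 * A)) = η / 2 := by field_simp
    calc (k : ℝ) * (η / (2 * A)) ≤ (A : ℝ) * (η / (2 * A)) := mul_le_mul_of_nonneg_right hkA'' (by positivity)
      _ = η / 2 := e
  rw [hlast] at hyoung
  have t := abs_sub_le (F s m g) (F s m fun i => if i < m - k then g' i else g i) (F s m g')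
  linarith

end Summit.QuantumFields.BalabanUV.T4Continuum.NE9.DirectPairingFamily
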